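import Mathlib
import Literature.MathematicalPhysics.QuantumLattice.HubbardBandSectorCountingToolbox
import Summits.HubbardSuperconductivity.HubbardSuperconductivity.Theorems.KLProgrammeKLRegimeTwoPointLimitShellAngularBound
import Summits.HubbardSuperconductivity.HubbardSuperconductivity.Theorems.KLProgrammeKLRegimeTwoPointLimitShellAngularBoundAway
import Summits.HubbardSuperconductivity.HubbardSuperconductivity.Theorems.KLProgrammeKLRegimeTwoPointLimitTwoShellArea
import HarnessLib

/-!
# Route `KLProgramme` — crux K3 `KLRegimeTwoPointLimit` (stmt-HubbardSuperconductivity-19937), support: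
# LEMMAS E.1 / E.3 OF DECOMP App. E AS ONE THEOREM — the two-shell phase-space bound of the
# square-lattice band for every transfer, constants depending only on the level window

Cell `gate-hubbard-kl`, seat p1b; paper note `HOME/prover-p1b/E1-NOTE.md` §2. This file closes the
seat's Lemma E.1/E.3 chain (13 earlier files) with the two statements the C1 induction (Lemma E.4),
C3's source identification and C5b's U5′ estimate actually cite:

* `kltb_exists_angular_bound` — for a bundle `B : BandBounds a b` and a margin `η⋆ > 0` there are
  `δ₀, v, C₁, C₂ > 0` such that for every level `μ` with `μ ± η⋆ ∈ [a, b]`, every `0 < δ ≤ δ₀`,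
  every transfer `w ∈ ℝ²` and every period, the angular sublevel set
  `Θ_w(δ) = {θ ∈ [θ₀, θ₀ + 2π] : |ε(p_μ(θ) - w) - μ| ≤ δ}` satisfies
  (i) `|Θ_w(δ)| ≤ C₁ δ/|w|_∞` if `0 < |w|_∞ ≤ v` (Cooper regime, LINEAR law — Lemma E.1),
  (ii) `|Θ_w(δ)| ≤ C₁ δ + C₂ √δ` if `w` keeps torus sup-distance `≥ v` from `2πℤ²` (transversal and
  caustic regimes, SQUARE-ROOT law — Lemma E.3), (iii) `|Θ_w(δ)| ≤ C₁ δ/r + C₂ √δ` for every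
  lower bound `0 < r ≤ dist_∞(w, 2πℤ²)` (uniform form, all `w`);
* `kltb_exists_twoShell_bound` — the AREA form on a compact sub-band `[a, b] ⊂ (-4, 0)` with margin
  `η⋆`: there are `ε₀, v, C₁, C₂ > 0` such that for `μ ∈ [a + η⋆, b - η⋆]`, `0 < ε₁ ≤ ε₂ ≤ ε₀` and
  every `w`, the two-shell set `S_μ(w; ε₁, ε₂) = {k ∈ [-π,π)² : |ε(k) - μ| < ε₁, |ε(k - w) - μ| ≤ ε₂}`
  (support of the particle–particle bubble at transfer `q = w` / particle–hole bubble at `Q = -w`)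
  has `Area ≤ C₁ ε₁` always, `≤ C₁ ε₁ε₂/|w|_∞` in the Cooper regime, `≤ C₁ ε₁ε₂ + C₂ ε₁√ε₂` away
  from the Cooper point, and `≤ C₁ ε₁ε₂/r + C₂ ε₁√ε₂` for every torus-distance lower bound `r > 0`
  — i.e. DECOMP App. E Lemma E.1's `C ε₁ min{1, ε₂/|q|_𝕋 + …}` and Lemma E.3's `C ε₁ ε₂^{1/2}`, with
  the curvature entering only through the fields of `bandBounds a b`.

Assembly only: `klan_exists_cooper_bound` + `klan_exists_away_bound` + periodicity / cell
representative (`klan_*`), and the tube reduction `klta_volume_twoShell_le`. Not here (E1-NOTE §6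
tail): the `ε₂/√dist(w, 2F)` refinement near the caustic, the interacting-curve version (needs the
curve-class definition, interface E1-NOTE §5), the scale sums (`…ShellScaleSums`).
-/

noncomputable section

-- the tree's namespace `Summit.<Summit>.<Problem>.Theorems` repeats the summit name by design (D-0017)
set_option linter.dupNamespace false

open Real Set MeasureTheory
open scoped ENNReal
open Literature.MathematicalPhysics.QuantumLattice
open Literature.MathematicalPhysics.QuantumLattice.BandSectorCounting

namespace Summit.HubbardSuperconductivity.HubbardSuperconductivity.Theorems

section Angular

variable {a b : ℝ} (B : BandBounds a b)
include B

/-- **Lemmas E.1 / E.3, angular form, every transfer.** See the module docstring: constants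
`δ₀, v, C₁, C₂ > 0` depending only on `B` and the margin `η⋆`, and the three clauses (i) Cooper
regime `C₁δ/|w|_∞`, (ii) torus distance `≥ v` from `2πℤ²`: `C₁δ + C₂√δ`, (iii) uniform:
`C₁δ/r + C₂√δ` for every lower bound `0 < r` of the torus sup-distance of `w` to `2πℤ²`. -/
theorem kltb_exists_angular_bound {ηs : ℝ} (hηs : 0 < ηs) :
    ∃ δ₀ v C₁ C₂ : ℝ, 0 < δ₀ ∧ 0 < v ∧ 0 < C₁ ∧ 0 < C₂ ∧
      ∀ (μ : ℝ), a ≤ μ - ηs → μ + ηs ≤ b → ∀ (δ w₁ w₂ θ₀ : ℝ), 0 < δ → δ ≤ δ₀ →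
        (0 < max |w₁| |w₂| → max |w₁| |w₂| ≤ v →
          volume {θ ∈ Icc θ₀ (θ₀ + 2 * π) | |eps2 (bandX μ θ - w₁) (bandY μ θ - w₂) - μ| ≤ δ} ≤
            ENNReal.ofReal (C₁ * δ / max |w₁| |w₂|)) ∧
        ((∀ m₀ m₁ : ℤ, v ≤ max |w₁ - m₀ * (2 * π)| |w₂ - m₁ * (2 * π)|) →
          volume {θ ∈ Icc θ₀ (θ₀ + 2 * π) | |eps2 (bandX μ θ - w₁) (bandY μ θ - w₂) - μ| ≤ δ} ≤
            ENNReal.ofReal (C₁ * δ + C₂ * Real.sqrt δ)) ∧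
        (∀ r : ℝ, 0 < r → (∀ m₀ m₁ : ℤ, r ≤ max |w₁ - m₀ * (2 * π)| |w₂ - m₁ * (2 * π)|) →
          volume {θ ∈ Icc θ₀ (θ₀ + 2 * π) | |eps2 (bandX μ θ - w₁) (bandY μ θ - w₂) - μ| ≤ δ} ≤
            ENNReal.ofReal (C₁ * δ / r + C₂ * Real.sqrt δ)) := by
  have hπ := Real.pi_pos
  obtain ⟨v, δa, Ca, hv0, hδa, hCa, hcoop⟩ := klan_exists_cooper_bound B hηs
  obtain ⟨δb, Cb, Cb₂, hδb, hCb, hCb₂, haway⟩ := klan_exists_away_bound B hηs hv0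
  refine ⟨min δa δb, v, Ca + 4 * Cb, Cb₂, lt_min hδa hδb, hv0, by positivity, hCb₂, ?_⟩
  intro μ hlo hhi δ w₁ w₂ θ₀ hδ hδ₀
  have hδa' : δ ≤ δa := hδ₀.trans (min_le_left _ _)
  have hδb' : δ ≤ δb := hδ₀.trans (min_le_right _ _)
  have hsq0 : 0 ≤ Cb₂ * Real.sqrt δ := by positivity
  refine ⟨fun hw0 hwv => ?_, fun hfar => ?_, fun r hr hrw => ?_⟩
  · -- (i) Cooper regime
    refine (hcoop μ hlo hhi δ w₁ w₂ θ₀ hδ hδa' hw0 hwv).trans (ENNReal.ofReal_le_ofReal ?_)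
    apply div_le_div_of_nonneg_right _ hw0.le
    have h0 : 0 ≤ 4 * Cb * δ := by positivity
    have e : (Ca + 4 * Cb) * δ = Ca * δ + 4 * Cb * δ := by ring
    rw [e]; linarith
  · -- (ii) away from the Cooper point
    refine (haway μ hlo hhi δ w₁ w₂ θ₀ hδ hδb' hfar).trans (ENNReal.ofReal_le_ofReal ?_)
    have h0 : 0 ≤ (Ca + 3 * Cb) * δ := by positivity
    have e : (Ca + 4 * Cb) * δ = Cb * δ + (Ca + 3 * Cb) * δ := by ring
    rw [e]; linarith
  · -- (iii) uniform: pass to the cell representative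
    obtain ⟨m₀, m₁, hrep⟩ := klan_exists_cell_rep w₁ w₂
    rw [← klan_sublevel_eq_of_sub_int_mul μ w₁ w₂ δ (Icc θ₀ (θ₀ + 2 * π)) m₀ m₁]
    set w₁' := w₁ - m₀ * (2 * π) with hw₁'
    set w₂' := w₂ - m₁ * (2 * π) with hw₂'
    have hr' : r ≤ max |w₁'| |w₂'| := hrw m₀ m₁
    have hw0 : 0 < max |w₁'| |w₂'| := hr.trans_le hr'
    have hle4 : r ≤ 4 := by linarith [hr'.trans hrep, Real.pi_lt_four]
    rcases le_or_gt (max |w₁'| |w₂'|) v with hwv | hwv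
    · refine (hcoop μ hlo hhi δ w₁' w₂' θ₀ hδ hδa' hw0 hwv).trans (ENNReal.ofReal_le_ofReal ?_)
      have h1 : Ca * δ / max |w₁'| |w₂'| ≤ Ca * δ / r :=
        div_le_div_of_nonneg_left (by positivity) hr hr'
      have h2 : Ca * δ / r ≤ (Ca + 4 * Cb) * δ / r := by
        apply div_le_div_of_nonneg_right _ hr.le
        have h0 : 0 ≤ 4 * Cb * δ := by positivity
        have e : (Ca + 4 * Cb) * δ = Ca * δ + 4 * Cb * δ := by ring
        rw [e]; linarith
      linarith
    · have hfar : ∀ n₀ n₁ : ℤ, v ≤ max |w₁' - n₀ * (2 * π)| |w₂' - n₁ * (2 * π)| :=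
        fun n₀ n₁ => hwv.le.trans (klse_supnorm_le_latticeDist hrep n₀ n₁)
      refine (haway μ hlo hhi δ w₁' w₂' θ₀ hδ hδb' hfar).trans (ENNReal.ofReal_le_ofReal ?_)
      -- `Cb δ ≤ 4 Cb δ / r ≤ (Ca + 4Cb) δ / r` since `r ≤ 4`
      have h1 : Cb * δ ≤ 4 * Cb * δ / r := by
        rw [le_div_iff₀ hr]
        have : Cb * δ * r ≤ Cb * δ * 4 := mul_le_mul_of_nonneg_left hle4 (by positivity)
        linarith
      have h2 : 4 * Cb * δ / r ≤ (Ca + 4 * Cb) * δ / r := by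
        apply div_le_div_of_nonneg_right _ hr.le
        have h0 : 0 ≤ Ca * δ := by positivity
        have e : (Ca + 4 * Cb) * δ = Ca * δ + 4 * Cb * δ := by ring
        rw [e]; linarith
      linarith

end Angular

/-! ### The two-shell area bound (DECOMP App. E Lemma E.1 / E.3, final form) -/

/-- **Lemmas E.1 / E.3 (DECOMP App. E), final form.** On a compact sub-band `[a, b] ⊂ (-4, 0)` with
margin `η⋆ > 0` there are `ε₀, v, C₁, C₂ > 0` such that for every level `μ ∈ [a + η⋆, b - η⋆]`,
all shell widths `0 < ε₁ ≤ ε₂ ≤ ε₀` and every transfer `w ∈ ℝ²`, the planar measure of the two-shell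
set `{k ∈ [-π,π)² : |ε(k) - μ| < ε₁, |ε(k - w) - μ| ≤ ε₂}` is (0) `≤ C₁ ε₁`; (i) `≤ C₁ ε₁ ε₂/|w|_∞`
when `0 < |w|_∞ ≤ v` (Cooper regime: the pp increments below the transfer scale are summable — the
freezing input of Lemma E.4); (ii) `≤ C₁ ε₁ ε₂ + C₂ ε₁ √ε₂` when `w` keeps torus sup-distance `≥ v`
from `2πℤ²` (incl. the `2k_F` caustic `2F_μ + 2πℤ²`: no logarithmic particle–hole flow in `d = 2`);
(iii) `≤ C₁ ε₁ ε₂/r + C₂ ε₁ √ε₂` for every `0 < r ≤ dist_∞(w, 2πℤ²)`. Constants from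
`bandBounds a b` (curvature via `h_min`, `a_min`) and the radius Lipschitz constant `L`. -/
theorem kltb_exists_twoShell_bound {a b : ℝ} (ha : -4 < a) (hab : a ≤ b) (hb : b < 0) {ηs : ℝ}
    (hηs : 0 < ηs) :
    ∃ ε₀ v C₁ C₂ : ℝ, 0 < ε₀ ∧ 0 < v ∧ 0 < C₁ ∧ 0 < C₂ ∧
      ∀ (μ ε₁ ε₂ w₁ w₂ : ℝ), a + ηs ≤ μ → μ ≤ b - ηs → 0 < ε₁ → ε₁ ≤ ε₂ → ε₂ ≤ ε₀ →
        (volume {x : ℝ × ℝ | (x.1 ∈ Ico (-π) π ∧ x.2 ∈ Ico (-π) π) ∧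
            |-2 * (Real.cos x.1 + Real.cos x.2) - μ| < ε₁ ∧
            |-2 * (Real.cos (x.1 - w₁) + Real.cos (x.2 - w₂)) - μ| ≤ ε₂} ≤
          ENNReal.ofReal (C₁ * ε₁)) ∧
        (0 < max |w₁| |w₂| → max |w₁| |w₂| ≤ v →
          volume {x : ℝ × ℝ | (x.1 ∈ Ico (-π) π ∧ x.2 ∈ Ico (-π) π) ∧
            |-2 * (Real.cos x.1 + Real.cos x.2) - μ| < ε₁ ∧
            |-2 * (Real.cos (x.1 - w₁) + Real.cos (x.2 - w₂)) - μ| ≤ ε₂} ≤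
          ENNReal.ofReal (C₁ * ε₁ * ε₂ / max |w₁| |w₂|)) ∧
        ((∀ m₀ m₁ : ℤ, v ≤ max |w₁ - m₀ * (2 * π)| |w₂ - m₁ * (2 * π)|) →
          volume {x : ℝ × ℝ | (x.1 ∈ Ico (-π) π ∧ x.2 ∈ Ico (-π) π) ∧
            |-2 * (Real.cos x.1 + Real.cos x.2) - μ| < ε₁ ∧
            |-2 * (Real.cos (x.1 - w₁) + Real.cos (x.2 - w₂)) - μ| ≤ ε₂} ≤
          ENNReal.ofReal (C₁ * ε₁ * ε₂ + C₂ * ε₁ * Real.sqrt ε₂)) ∧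
        (∀ r : ℝ, 0 < r → (∀ m₀ m₁ : ℤ, r ≤ max |w₁ - m₀ * (2 * π)| |w₂ - m₁ * (2 * π)|) →
          volume {x : ℝ × ℝ | (x.1 ∈ Ico (-π) π ∧ x.2 ∈ Ico (-π) π) ∧
            |-2 * (Real.cos x.1 + Real.cos x.2) - μ| < ε₁ ∧
            |-2 * (Real.cos (x.1 - w₁) + Real.cos (x.2 - w₂)) - μ| ≤ ε₂} ≤
          ENNReal.ofReal (C₁ * ε₁ * ε₂ / r + C₂ * ε₁ * Real.sqrt ε₂)) := by
  have hπ := Real.pi_pos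
  set B : BandBounds a b := bandBounds ha hab hb with hB
  obtain ⟨L, hL0, hL⟩ := klta_volume_twoShell_le ha hb
  obtain ⟨δ₀, v, C₁, C₂, hδ₀, hv0, hC₁, hC₂, hang⟩ := kltb_exists_angular_bound B hηs
  -- constants
  obtain ⟨K, hK⟩ : ∃ x : ℝ, x = 1 + 4 * L := ⟨_, rfl⟩
  have hK1 : 1 ≤ K := by rw [hK]; linarith
  have hK0 : 0 < K := by linarith
  obtain ⟨ε₀, hε₀⟩ : ∃ x : ℝ, x = min ηs (δ₀ / K) := ⟨_, rfl⟩
  have hε₀0 : 0 < ε₀ := by rw [hε₀]; exact lt_min hηs (by positivity)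
  have hε₀1 : ε₀ ≤ ηs := by rw [hε₀]; exact min_le_left _ _
  have hε₀2 : ε₀ ≤ δ₀ / K := by rw [hε₀]; exact min_le_right _ _
  obtain ⟨D₁, hD₁⟩ : ∃ x : ℝ, x = 16 * L * K * C₁ + 32 * π * L + 1 := ⟨_, rfl⟩
  obtain ⟨D₂, hD₂⟩ : ∃ x : ℝ, x = 16 * L * Real.sqrt K * C₂ + 1 := ⟨_, rfl⟩
  have hD₁0 : 0 < D₁ := by rw [hD₁]; positivity
  have hD₂0 : 0 < D₂ := by rw [hD₂]; positivity
  refine ⟨ε₀, v, D₁, D₂, hε₀0, hv0, hD₁0, hD₂0, ?_⟩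
  intro μ ε₁ ε₂ w₁ w₂ hμ1 hμ2 hε₁ hε12 hε2
  have hε₁s : ε₁ ≤ ηs := hε12.trans (hε2.trans hε₀1)
  have hm1 : μ - ε₁ ∈ Icc a b := ⟨by linarith, by linarith⟩
  have hm2 : μ + ε₁ ∈ Icc a b := ⟨by linarith, by linarith⟩
  have hlo : a ≤ μ - ηs := by linarith
  have hhi : μ + ηs ≤ b := by linarith
  have htube := hL μ ε₁ ε₂ w₁ w₂ hε₁ hm1 hm2
  -- the angular parameter `δ = ε₂ + 4Lε₁ ≤ K ε₂ ≤ δ₀`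
  set δ : ℝ := ε₂ + 4 * L * ε₁ with hδ
  have hε₂ : 0 < ε₂ := hε₁.trans_le hε12
  have hδ0 : 0 < δ := by positivity
  have hδK : δ ≤ K * ε₂ := by
    rw [hδ, hK]
    have : 4 * L * ε₁ ≤ 4 * L * ε₂ := mul_le_mul_of_nonneg_left hε12 (by positivity)
    linarith
  have hδδ₀ : δ ≤ δ₀ := by
    have : K * ε₂ ≤ K * (δ₀ / K) := mul_le_mul_of_nonneg_left (hε2.trans hε₀2) hK0.le
    have e : K * (δ₀ / K) = δ₀ := by field_simp
    linarith
  have hsqδ : Real.sqrt δ ≤ Real.sqrt K * Real.sqrt ε₂ := by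
    rw [← Real.sqrt_mul hK0.le]; exact Real.sqrt_le_sqrt hδK
  obtain ⟨hA1, hA2, hA3⟩ := hang μ hlo hhi δ w₁ w₂ (-π) hδ0 hδδ₀
  -- from the period `[-π, π]` to the open interval
  have hsub : {θ ∈ Ioo (-π) π | |eps2 (bandX μ θ - w₁) (bandY μ θ - w₂) - μ| ≤ δ} ⊆
      {θ ∈ Icc (-π) (-π + 2 * π) | |eps2 (bandX μ θ - w₁) (bandY μ θ - w₂) - μ| ≤ δ} := by
    intro θ hθ
    exact ⟨⟨hθ.1.1.le, by linarith [hθ.1.2]⟩, hθ.2⟩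
  have hmono := measure_mono (μ := volume) hsub
  -- the generic step: an angular bound `X` gives the area bound `16 L ε₁ X`
  have step : ∀ X : ℝ, 0 ≤ X →
      volume {θ ∈ Icc (-π) (-π + 2 * π) | |eps2 (bandX μ θ - w₁) (bandY μ θ - w₂) - μ| ≤ δ} ≤
        ENNReal.ofReal X →
      volume {x : ℝ × ℝ | (x.1 ∈ Ico (-π) π ∧ x.2 ∈ Ico (-π) π) ∧
          |-2 * (Real.cos x.1 + Real.cos x.2) - μ| < ε₁ ∧
          |-2 * (Real.cos (x.1 - w₁) + Real.cos (x.2 - w₂)) - μ| ≤ ε₂} ≤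
        ENNReal.ofReal (16 * L * ε₁ * X) := by
    intro X hX hvol
    calc _ ≤ ENNReal.ofReal (16 * L * ε₁) *
          volume {θ ∈ Ioo (-π) π | |eps2 (bandX μ θ - w₁) (bandY μ θ - w₂) - μ| ≤ δ} := htube
      _ ≤ ENNReal.ofReal (16 * L * ε₁) * ENNReal.ofReal X := by gcongr; exact hmono.trans hvol
      _ = ENNReal.ofReal (16 * L * ε₁ * X) := (ENNReal.ofReal_mul (by positivity)).symm
  have h16 : 0 ≤ 16 * L * ε₁ := by positivity
  refine ⟨?_, fun hw0 hwv => ?_, fun hfar => ?_, fun r hr hrw => ?_⟩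
  · -- (0) the trivial angular bound `2π`
    have h := step (2 * π) (by positivity) (klan_volume_sublevel_le_two_pi μ w₁ w₂ δ (-π))
    refine h.trans (ENNReal.ofReal_le_ofReal ?_)
    rw [hD₁]
    have h1 : 0 ≤ 16 * L * K * C₁ * ε₁ + ε₁ := by positivity
    have e : (16 * L * K * C₁ + 32 * π * L + 1) * ε₁ =
        16 * L * ε₁ * (2 * π) + (16 * L * K * C₁ * ε₁ + ε₁) := by ring
    rw [e]; linarith
  · -- (i) Cooper regime
    have h := step _ (by positivity) (hA1 hw0 hwv)
    refine h.trans (ENNReal.ofReal_le_ofReal ?_)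
    rw [hD₁]
    have h1 : C₁ * δ / max |w₁| |w₂| ≤ C₁ * (K * ε₂) / max |w₁| |w₂| :=
      div_le_div_of_nonneg_right (mul_le_mul_of_nonneg_left hδK hC₁.le) hw0.le
    have h2 : 16 * L * ε₁ * (C₁ * (K * ε₂) / max |w₁| |w₂|) =
        16 * L * K * C₁ * ε₁ * ε₂ / max |w₁| |w₂| := by ring
    have h3 : 16 * L * K * C₁ * ε₁ * ε₂ / max |w₁| |w₂| ≤
        (16 * L * K * C₁ + 32 * π * L + 1) * ε₁ * ε₂ / max |w₁| |w₂| := by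
      apply div_le_div_of_nonneg_right _ hw0.le
      have h0 : 0 ≤ (32 * π * L + 1) * ε₁ * ε₂ := by positivity
      have e : (16 * L * K * C₁ + 32 * π * L + 1) * ε₁ * ε₂ =
          16 * L * K * C₁ * ε₁ * ε₂ + (32 * π * L + 1) * ε₁ * ε₂ := by ring
      rw [e]; linarith
    have h4 := mul_le_mul_of_nonneg_left h1 h16
    rw [h2] at h4
    exact h4.trans h3
  · -- (ii) away from the Cooper point
    have h := step _ (by positivity) (hA2 hfar)
    refine h.trans (ENNReal.ofReal_le_ofReal ?_)
    rw [hD₁, hD₂]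
    have h1 : C₁ * δ ≤ C₁ * (K * ε₂) := mul_le_mul_of_nonneg_left hδK hC₁.le
    have h2 : C₂ * Real.sqrt δ ≤ C₂ * (Real.sqrt K * Real.sqrt ε₂) :=
      mul_le_mul_of_nonneg_left hsqδ hC₂.le
    have h3 : 16 * L * ε₁ * (C₁ * δ + C₂ * Real.sqrt δ) ≤
        16 * L * ε₁ * (C₁ * (K * ε₂) + C₂ * (Real.sqrt K * Real.sqrt ε₂)) :=
      mul_le_mul_of_nonneg_left (by linarith) h16
    have h4 : 0 ≤ (32 * π * L + 1) * ε₁ * ε₂ := by positivity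
    have h5 : 0 ≤ ε₁ * Real.sqrt ε₂ := by positivity
    have e : (16 * L * K * C₁ + 32 * π * L + 1) * ε₁ * ε₂ +
        (16 * L * Real.sqrt K * C₂ + 1) * ε₁ * Real.sqrt ε₂ =
        16 * L * ε₁ * (C₁ * (K * ε₂) + C₂ * (Real.sqrt K * Real.sqrt ε₂)) +
        ((32 * π * L + 1) * ε₁ * ε₂ + ε₁ * Real.sqrt ε₂) := by ring
    rw [e]; linarith
  · -- (iii) uniform
    have h := step _ (by positivity) (hA3 r hr hrw)
    refine h.trans (ENNReal.ofReal_le_ofReal ?_)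
    rw [hD₁, hD₂]
    have h1 : C₁ * δ / r ≤ C₁ * (K * ε₂) / r :=
      div_le_div_of_nonneg_right (mul_le_mul_of_nonneg_left hδK hC₁.le) hr.le
    have h2 : C₂ * Real.sqrt δ ≤ C₂ * (Real.sqrt K * Real.sqrt ε₂) :=
      mul_le_mul_of_nonneg_left hsqδ hC₂.le
    have h3 : 16 * L * ε₁ * (C₁ * δ / r + C₂ * Real.sqrt δ) ≤
        16 * L * ε₁ * (C₁ * (K * ε₂) / r + C₂ * (Real.sqrt K * Real.sqrt ε₂)) :=
      mul_le_mul_of_nonneg_left (by linarith) h16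
    have h4 : 16 * L * ε₁ * (C₁ * (K * ε₂) / r) = 16 * L * K * C₁ * ε₁ * ε₂ / r := by ring
    have h5 : 16 * L * K * C₁ * ε₁ * ε₂ / r ≤ (16 * L * K * C₁ + 32 * π * L + 1) * ε₁ * ε₂ / r := by
      apply div_le_div_of_nonneg_right _ hr.le
      have h0 : 0 ≤ (32 * π * L + 1) * ε₁ * ε₂ := by positivity
      have e : (16 * L * K * C₁ + 32 * π * L + 1) * ε₁ * ε₂ =
          16 * L * K * C₁ * ε₁ * ε₂ + (32 * π * L + 1) * ε₁ * ε₂ := by ring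
      rw [e]; linarith
    have h6 : 0 ≤ ε₁ * Real.sqrt ε₂ := by positivity
    have e1 : 16 * L * ε₁ * (C₁ * (K * ε₂) / r + C₂ * (Real.sqrt K * Real.sqrt ε₂)) =
        16 * L * K * C₁ * ε₁ * ε₂ / r + 16 * L * Real.sqrt K * C₂ * (ε₁ * Real.sqrt ε₂) := by ring
    have e2 : (16 * L * Real.sqrt K * C₂ + 1) * ε₁ * Real.sqrt ε₂ =
        16 * L * Real.sqrt K * C₂ * (ε₁ * Real.sqrt ε₂) + ε₁ * Real.sqrt ε₂ := by ring
    rw [e2]; linarith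

end Summit.HubbardSuperconductivity.HubbardSuperconductivity.Theorems

end
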